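import Literature.NumberTheory.LFunctions.Zhang2022.Section3Lemma31
import Literature.NumberTheory.LFunctions.Zhang2022.RepairBedScale
import HarnessLib

/-!
# Zhang (2022), rescue GAP/REQSIDE (D-0124 (4)–(5)): the SCALE LAW of Lemma 3.1 — with the range
# `N ≤ exp(2𝓛^{x})` the tail `∑_{D⁴<n≤N} ν(n)²/n` is `≪ 𝓛^{−k}` as soon as `‖L(1,χ)‖ ≤ 𝓛^{−(k+2+x)}`
# (printed `x = 9`, `k = 2011`: exponent `2022`)

Topic `Literature/NumberTheory/LFunctions/Zhang2022` (Landau–Siegel audit tree; verdict-neutral).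
Y. Zhang, *Discrete mean estimates and the Landau–Siegel zero*, arXiv:2211.02515v1 (2022)
[Zhang2022LandauSiegel] — **an unrefereed manuscript under adjudication; nothing in this file asserts or
denies its Theorems 1–2, and nothing here is a claim about Landau–Siegel zeros. The programme SEARCHES and
TYPES; no claim about Landau–Siegel zeros, Theorems 1–2 of arXiv:2211.02515 or a repaired Margin232 until a
kernel theorem says so.**

Lemma 3.1 (§3 p. 7: "Assume (A) holds. Then `∑_{D⁴<n≤P²} ν(n)²/n ≪ 𝓛^{−2011}`", `P = exp 𝓛⁹` (2.6),
(A) = `L(1,χ) < 𝓛^{−2022}`) is the tree theorem `Lemma31.lemma_3_1` (file `Section3Lemma31`, with the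
printed exponents as literals). The rescue's exponent bookkeeping (kit LP-3 j271838; kernel twin
`Repair.Gap.ExpTuple`, file `RepairGapExponentBudget`) carries this step as the DESK READING
«Lemma 3.1 saving `s₁ = E − 2 − x_P`» (`ExpTuple.s1`; `E` the exponent of (A), `log P = 𝓛^{x_P}`), one of the
located linear constraints whose arithmetic gives `E_min(S0) = 2000` (`ExpTuple.budgetS0_2000`). This file
DERIVES that reading from the analysis itself — the tree's proof of Lemma 3.1 re-run with the three
exponents left free:

* `lemma31_scale_of_norm_le` — SUFFICIENCY: for natural `x ≥ 2` and `k`, there is `C = C(x,k)` with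
  `∑_{D⁴<n≤N} |ν(n)|²/n ≤ C𝓛^{−k}` for every `N ≤ exp(2𝓛^{x})`, every `D` with `log D ≥ 3` and every primitive
  quadratic `χ` mod `D` with `‖L(1,χ)‖ ≤ 𝓛^{−(k+2+x)}`. The three terms of the tree's explicit formula
  (`DivisorSumCharSq.explicit_formula`) cost: `g(0)(W_d(B) − W_d(A))`: `3𝓛^{−2E}·9𝓛^{2x}` (needs `2E ≥ k + 2x`);
  `(log B − log A)g′(0)`: `2𝓛^{x}·3(1+4e^{9/2})²𝓛^{−(E−2)}` by Cauchy on `|z| = 𝓛^{−(E+2)}` with the tree's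
  `L′ ≪ (1+𝓛)𝓛` near `1` — THE BINDING TERM, `E − 2 − x ≥ k`; the shifted line: `O_k(d(D)²D^{−3/4}(1+𝓛)³) ≤
  C_k𝓛^{−k}` for every `k` (`aux_logpow_scale`).
* `lemma31_scale_floor`, `lemma31_scale_complex` — the printed shapes (`N = ⌊exp(2𝓛^{x})⌋`, complex `ν(n)²`).
* `lemma31_scale_of_assumptionAWith` — hence `Repair.Bed.AssumptionAWith E` suffices for every real
  `E ≥ k + 2 + x`.

At the printed `x = 9`, `k = 2011` the premise exponent is `2011 + 2 + 9 = 2022` and `lemma31_scale_of_norm_le 9 2011`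
has literally the statement of `Lemma31.lemma_3_1` (not restated). READING (GAP G-31 / REQSIDE (5), as-typed): the
(A)-exponent Lemma 3.1 consumes for a saving `𝓛^{−k}` over the range `n ≤ exp(2𝓛^{x})` is `k + 2 + x` — the desk's
`s₁ = E − 2 − x_P` as a theorem about `L`-functions (sufficiency; the `2` is the tree's convexity-strength input
`L′(σ,χ) ≪ (1+𝓛)𝓛` near `σ = 1`, not a feature of the manuscript). In particular the SHORT tail `D⁴ < n ≤ D⁸` that
Lemma 17.1 (Appendix B) consumes is the case `x = 3` (`D⁸ ≤ exp(2𝓛³)` for `log D ≥ 2`): saving `𝓛^{−k}` from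
`‖L(1,χ)‖ ≤ 𝓛^{−(k+5)}`. Where the rest of (A) is consumed (Prop. 2.1's exceptional-set route) is not this file's
subject. Theorems only; no definition, no named fact; nothing about (A) itself is asserted.

## References

* Y. Zhang, arXiv:2211.02515v1 (2022), §3 Lemma 3.1 and its proof (p. 7); §2 (2.6); Assumption (A) p. 4.
  [cite: Zhang2022LandauSiegel, §3, Lemma 3.1; §2 (2.6)]
-/

noncomputable section

open Complex Filter Topology Set MeasureTheory Real Metric
open scoped LSeries.notation

namespace Literature.NumberTheory.LFunctions.Zhang2022.Repair.Gap

open Literature.NumberTheory.LFunctions.DivisorSumCharSq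
open Literature.NumberTheory.LFunctions.ZetaM4 (dCoeff integrable_pow_mul_exp integral_pow_mul_exp_le)
open Literature.NumberTheory.LFunctions.Zhang2022.Lemma31 (aux_AB eight_lt_exp_three ne_one_of_isPrimitive
  sum_Ioc_le norm_phi_one_add_le norm_W_dCoeff_sub_le norm_deriv_gFun_zero_le norm_integral_line_le Kline
  Kline_pos divisorSumChar_sq_eq)
open Literature.NumberTheory.LFunctions.Zhang2022.Repair.Bed (AssumptionAWith)

/-! ## Bookkeeping in `𝓛 = log D` with the exponents free -/

/-- Elementary facts about the cut-offs `A = D⁴`, `B = exp(2𝓛^{x})` for `𝓛 = log D ≥ 3` and a natural scale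
exponent `x ≥ 2` (the tree's `Lemma31.aux_AB` is the case `x = 9`): `A > 0`, `4A ≤ B`,
`A^{−1/4} + B^{−1/4} ≤ 2/D`, `|log B − log A| ≤ 2𝓛^{x}`, `log(1 + 2B) ≤ 3𝓛^{x}` — the cut-off bookkeeping of the
proof of Lemma 3.1 with the scale free. [cite: Zhang2022LandauSiegel, §3, proof of Lemma 3.1] -/
theorem aux_AB_scale {D : ℕ} (hL : 3 ≤ Real.log D) {x : ℕ} (hx : 2 ≤ x) :
    0 < ((D : ℝ) ^ 4) ∧ 4 * (D : ℝ) ^ 4 ≤ Real.exp (2 * Real.log D ^ x) ∧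
    ((D : ℝ) ^ 4) ^ (-(1 / 4) : ℝ) + (Real.exp (2 * Real.log D ^ x)) ^ (-(1 / 4) : ℝ) ≤ 2 / D ∧
    |Real.log (Real.exp (2 * Real.log D ^ x)) - Real.log ((D : ℝ) ^ 4)| ≤ 2 * Real.log D ^ x ∧
    Real.log (1 + 2 * Real.exp (2 * Real.log D ^ x)) ≤ 3 * Real.log D ^ x := by
  set Lg : ℝ := Real.log D with hLdef
  have hL1 : 1 ≤ Lg := by linarith
  have hD0 : (0 : ℝ) < D := by
    rcases Nat.eq_zero_or_pos D with h | h
    · rw [h] at hLdef; simp [hLdef] at hL; linarith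
    · exact_mod_cast h
  have hDexp : (D : ℝ) = Real.exp Lg := (Real.exp_log hD0).symm
  -- `Lg^x ≥ Lg² ≥ 3 Lg`
  have hLx : 3 * Lg ≤ Lg ^ x := by
    have h2 : Lg ^ 2 ≤ Lg ^ x := pow_le_pow_right₀ hL1 hx
    nlinarith
  refine ⟨by positivity, ?_, ?_, ?_, ?_⟩
  · -- `4 D⁴ ≤ exp(2 Lg^x)`
    have h4 : (4 : ℝ) ≤ Real.exp 2 := by
      have := Real.add_one_le_exp (1 : ℝ)
      have h := Real.exp_one_gt_d9
      rw [show (2 : ℝ) = 1 + 1 by norm_num, Real.exp_add]; nlinarith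
    rw [hDexp, ← Real.exp_nat_mul]
    calc 4 * Real.exp ((4 : ℕ) * Lg) ≤ Real.exp 2 * Real.exp ((4 : ℕ) * Lg) := by gcongr
      _ = Real.exp (2 + 4 * Lg) := by rw [← Real.exp_add]; norm_num
      _ ≤ Real.exp (2 * Lg ^ x) := Real.exp_le_exp.2 (by nlinarith)
  · -- `A^{-1/4} + B^{-1/4} ≤ 2/D`
    have hA : ((D : ℝ) ^ 4) ^ (-(1 / 4) : ℝ) = (D : ℝ)⁻¹ := by
      rw [← Real.rpow_natCast, ← Real.rpow_mul hD0.le]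
      norm_num
      exact Real.rpow_neg_one _
    have hB : (Real.exp (2 * Lg ^ x)) ^ (-(1 / 4) : ℝ) ≤ (D : ℝ)⁻¹ := by
      rw [← Real.exp_mul, hDexp, ← Real.exp_neg, Real.exp_le_exp]
      nlinarith
    rw [hA]
    calc (D : ℝ)⁻¹ + (Real.exp (2 * Lg ^ x)) ^ (-(1 / 4) : ℝ) ≤ (D : ℝ)⁻¹ + (D : ℝ)⁻¹ := by linarith
      _ = 2 / D := by ring
  · -- `|log B − log A| ≤ 2 Lg^x`
    rw [Real.log_exp, Real.log_pow, ← hLdef]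
    push_cast
    rw [abs_le]; constructor <;> nlinarith
  · -- `log(1 + 2B) ≤ 3 Lg^x`
    have hE := Real.exp_pos (2 * Lg ^ x)
    have h1 : 1 + 2 * Real.exp (2 * Lg ^ x) ≤ 3 * Real.exp (2 * Lg ^ x) := by
      have := Real.one_le_exp (by positivity : (0:ℝ) ≤ 2 * Lg ^ x); linarith
    have hlog3 : Real.log 3 ≤ 2 := by
      have := Real.log_le_sub_one_of_pos (by norm_num : (0:ℝ) < 3); linarith
    calc Real.log (1 + 2 * Real.exp (2 * Lg ^ x)) ≤ Real.log (3 * Real.exp (2 * Lg ^ x)) :=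
          Real.log_le_log (by positivity) h1
      _ = Real.log 3 + 2 * Lg ^ x := by rw [Real.log_mul (by norm_num) hE.ne', Real.log_exp]
      _ ≤ 3 * Lg ^ x := by nlinarith

/-- `(1 + 𝓛)³ / D^{1/2} ≤ 8 · (2(m+3))^{m+3} / 𝓛^{m}` for `𝓛 = log D ≥ 1` and every natural `m`
(`𝓛 ≤ c·D^{1/c}` with `c = 2(m+3)`, Mathlib's `Real.log_le_rpow_div`; the tree's `Lemma31.aux_logpow` is the
case `m = 2011`) — the «`D^{−1/2}(1+𝓛)³ = O(𝓛^{−2011})`» step of the proof of Lemma 3.1 with the exponent free.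
[cite: Zhang2022LandauSiegel, §3, proof of Lemma 3.1] -/
theorem aux_logpow_scale (m : ℕ) {D : ℕ} (hL : 1 ≤ Real.log D) (hD0 : (0 : ℝ) < D) :
    (1 + Real.log D) ^ 3 / (D : ℝ) ^ (1 / 2 : ℝ) ≤
      8 * (2 * ((m : ℝ) + 3)) ^ (m + 3) / Real.log D ^ m := by
  set Lg : ℝ := Real.log D with hLdef
  set c : ℝ := 2 * ((m : ℝ) + 3) with hcdef
  have hc0 : 0 < c := by rw [hcdef]; positivity
  have hL0 : 0 < Lg := by linarith
  have h1 : Lg ≤ (D : ℝ) ^ (1 / c) / (1 / c) := Real.log_le_rpow_div hD0.le (by positivity)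
  have h2 : Lg / c ≤ (D : ℝ) ^ (1 / c) := by
    rw [div_le_iff₀ hc0]
    have : (D : ℝ) ^ (1 / c) / (1 / c) = (D : ℝ) ^ (1 / c) * c := by
      rw [div_div_eq_mul_div, div_one]
    linarith
  have h3 : (Lg / c) ^ (m + 3) ≤ (D : ℝ) ^ (1 / 2 : ℝ) := by
    calc (Lg / c) ^ (m + 3) ≤ ((D : ℝ) ^ (1 / c)) ^ (m + 3) := pow_le_pow_left₀ (by positivity) h2 _
      _ = (D : ℝ) ^ (1 / 2 : ℝ) := by
          rw [← Real.rpow_natCast, ← Real.rpow_mul hD0.le]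
          congr 1
          rw [hcdef]; push_cast; field_simp
  have hDhalf : 0 < (D : ℝ) ^ (1 / 2 : ℝ) := by positivity
  have h4 : (1 + Lg) ^ 3 ≤ 8 * Lg ^ 3 := by
    have : 1 + Lg ≤ 2 * Lg := by linarith
    calc (1 + Lg) ^ 3 ≤ (2 * Lg) ^ 3 := pow_le_pow_left₀ (by linarith) this 3
      _ = 8 * Lg ^ 3 := by ring
  have h5 : 0 < (Lg / c) ^ (m + 3) := by positivity
  calc (1 + Lg) ^ 3 / (D : ℝ) ^ (1 / 2 : ℝ) ≤ 8 * Lg ^ 3 / (Lg / c) ^ (m + 3) := by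
        gcongr
    _ = 8 * c ^ (m + 3) / Lg ^ m := by
        have hLm3 : Lg ^ (m + 3) = Lg ^ m * Lg ^ 3 := by rw [← pow_add]
        rw [div_pow, hLm3]
        field_simp

/-- The residue-term bookkeeping with the exponent free: with `r = 𝓛^{−(m+4)}`, `X = ‖L(1,χ)‖ ≤ 𝓛^{−(m+2)}` and
`C_L = 2e^{9/2}(1+𝓛)𝓛`, `3 (X + C_L r)²/r ≤ 3 (1 + 4e^{9/2})² 𝓛^{−m}` (`𝓛 ≥ 1`; the tree's `Lemma31.aux_deriv` is
`m = 2020`) — the «`𝓛^{2024}·𝓛^{−4044}`» count of the proof of Lemma 3.1 with the exponent free.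
[cite: Zhang2022LandauSiegel, §3, proof of Lemma 3.1] -/
theorem aux_deriv_scale (m : ℕ) {Lg X : ℝ} (hL : 1 ≤ Lg) (hX0 : 0 ≤ X) (hX : X ≤ 1 / Lg ^ (m + 2)) :
    3 * (X + 2 * Real.exp (9 / 2) * (1 + Lg) * Lg * (1 / Lg ^ (m + 4))) ^ 2 / (1 / Lg ^ (m + 4)) ≤
      3 * (1 + 4 * Real.exp (9 / 2)) ^ 2 / Lg ^ m := by
  have hL0 : 0 < Lg := by linarith
  have hE := Real.exp_pos (9 / 2)
  have hm4 : Lg ^ (m + 4) = Lg ^ 2 * Lg ^ (m + 2) := by rw [← pow_add]; ring_nf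
  have h1 : 2 * Real.exp (9 / 2) * (1 + Lg) * Lg * (1 / Lg ^ (m + 4)) ≤
      4 * Real.exp (9 / 2) / Lg ^ (m + 2) := by
    have h2L : (1 + Lg) * Lg ≤ 2 * Lg ^ 2 := by nlinarith
    rw [show 2 * Real.exp (9 / 2) * (1 + Lg) * Lg * (1 / Lg ^ (m + 4)) =
        2 * Real.exp (9 / 2) * ((1 + Lg) * Lg) / Lg ^ (m + 4) by ring]
    rw [div_le_div_iff₀ (by positivity) (by positivity), hm4]
    have hm := mul_le_mul_of_nonneg_left h2L hE.le
    nlinarith [hm, pow_pos hL0 (m + 2)]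
  have h2 : X + 2 * Real.exp (9 / 2) * (1 + Lg) * Lg * (1 / Lg ^ (m + 4)) ≤
      (1 + 4 * Real.exp (9 / 2)) / Lg ^ (m + 2) := by
    have : (1 + 4 * Real.exp (9 / 2)) / Lg ^ (m + 2) =
        1 / Lg ^ (m + 2) + 4 * Real.exp (9 / 2) / Lg ^ (m + 2) := by
      ring
    rw [this]
    linarith
  have h0 : 0 ≤ X + 2 * Real.exp (9 / 2) * (1 + Lg) * Lg * (1 / Lg ^ (m + 4)) := by positivity
  have h3 : (X + 2 * Real.exp (9 / 2) * (1 + Lg) * Lg * (1 / Lg ^ (m + 4))) ^ 2 ≤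
      ((1 + 4 * Real.exp (9 / 2)) / Lg ^ (m + 2)) ^ 2 := pow_le_pow_left₀ h0 h2 2
  calc 3 * (X + 2 * Real.exp (9 / 2) * (1 + Lg) * Lg * (1 / Lg ^ (m + 4))) ^ 2 / (1 / Lg ^ (m + 4))
      = 3 * (X + 2 * Real.exp (9 / 2) * (1 + Lg) * Lg * (1 / Lg ^ (m + 4))) ^ 2 * Lg ^ (m + 4) := by
        field_simp
    _ ≤ 3 * ((1 + 4 * Real.exp (9 / 2)) / Lg ^ (m + 2)) ^ 2 * Lg ^ (m + 4) := by gcongr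
    _ = 3 * (1 + 4 * Real.exp (9 / 2)) ^ 2 / Lg ^ m := by
        have : (Lg ^ (m + 2)) ^ 2 = Lg ^ (m + 4) * Lg ^ m := by rw [← pow_mul, ← pow_add]; ring_nf
        rw [div_pow, this]
        field_simp

/-! ## The scale law: saving `𝓛^{−k}` over `n ≤ exp(2𝓛^{x})` from `‖L(1,χ)‖ ≤ 𝓛^{−(k+2+x)}` -/

/-- **Lemma 3.1 with the exponents free (sufficiency).** For natural `x ≥ 2` and `k` there is a constant
`C = C(x,k)` such that for every `D` with `log D ≥ 3`, every PRIMITIVE Dirichlet character `χ` mod `D` with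
`χ² = 1` and `‖L(1,χ)‖ ≤ (log D)^{−(k+2+x)}`, and every `N ≤ exp(2(log D)^{x})`,
`∑_{D⁴<n≤N} |ν(n)|²/n ≤ C (log D)^{−k}` (`ν(n) = ∑_{d∣n} χ(d)`). The tree's proof of `Lemma31.lemma_3_1`
verbatim with `2022 ↦ k+2+x`, `P² = exp(2𝓛⁹) ↦ exp(2𝓛^{x})`, Cauchy radius `𝓛^{−2024} ↦ 𝓛^{−(k+x+4)}`; the printed
lemma is `x = 9`, `k = 2011`. This is the desk reading «`s₁ = E − 2 − x_P`» of `Repair.Gap.ExpTuple.s1` as a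
theorem. [cite: Zhang2022LandauSiegel, §3, Lemma 3.1] -/
theorem lemma31_scale_of_norm_le (x k : ℕ) (hx : 2 ≤ x) :
    ∃ C : ℝ, ∀ (D : ℕ) [NeZero D] (χ : DirichletCharacter ℂ D),
    χ.IsPrimitive → χ ^ 2 = 1 → 3 ≤ Real.log D →
    ‖χ.LFunction 1‖ ≤ 1 / Real.log D ^ (k + 2 + x) →
    ∀ N : ℕ, (N : ℝ) ≤ Real.exp (2 * Real.log D ^ x) →
      ∑ n ∈ Finset.Ioc (D ^ 4) N, ‖divisorSumChar χ n‖ ^ 2 / n ≤ C / Real.log D ^ k := by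
  obtain ⟨Cd, hCd1, hCd⟩ := Sieve.exists_card_divisors_le_mul_rpow (by norm_num : (0 : ℝ) < 1 / 8)
  refine ⟨6 * (27 + 6 * (1 + 4 * Real.exp (9 / 2)) ^ 2 +
    16 * 28 ^ 13 * Kline * Cd ^ 2 * (8 * (2 * ((k : ℝ) + 3)) ^ (k + 3))), ?_⟩
  intro D _ χ hprim hχ2 hL hA N hN
  set M : ℝ := (2 * ((k : ℝ) + 3)) ^ (k + 3) with hM
  set Lg : ℝ := Real.log D with hLdef
  have hL1 : 1 ≤ Lg := by linarith
  have hL0 : 0 < Lg := by linarith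
  -- the premise exponent `E = k + 2 + x = (k + x) + 2`
  have hEeq : Lg ^ (k + 2 + x) = Lg ^ (k + x + 2) := by ring_nf
  have hA' : ‖χ.LFunction 1‖ ≤ 1 / Lg ^ (k + x + 2) := by rw [← hEeq]; exact hA
  -- `D > 8`
  have hD0 : D ≠ 0 := by
    rintro rfl; simp [hLdef] at hL; linarith
  have hDpos : (0 : ℝ) < D := by exact_mod_cast Nat.pos_of_ne_zero hD0
  have hD8 : 8 ≤ D := by
    have h1 : Real.exp 3 ≤ Real.exp Lg := Real.exp_le_exp.2 hL
    rw [hLdef, Real.exp_log hDpos] at h1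
    have := eight_lt_exp_three
    exact_mod_cast (show (8 : ℝ) ≤ D by linarith)
  have hχ1 := ne_one_of_isPrimitive χ (by omega) hprim
  have hLA1 : ‖χ.LFunction 1‖ ≤ 1 := by
    refine hA.trans ?_
    rw [div_le_one (by positivity)]
    exact one_le_pow₀ hL1
  -- the two cut-offs
  obtain ⟨hApos, h4AB, hABsum, hΔlog, hlogB⟩ := aux_AB_scale (D := D) hL hx
  set A : ℝ := (D : ℝ) ^ 4 with hAdef
  set B : ℝ := Real.exp (2 * Lg ^ x) with hBdef
  have hBpos : 0 < B := Real.exp_pos _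
  have hAB : A ≤ B := by linarith
  -- (1) smoothing
  have hS := sum_Ioc_le χ hχ2 hApos h4AB (M := D ^ 4) (N := N)
    (by rw [hAdef]; push_cast; exact le_rfl) hN
  -- (2) the explicit formula
  have hEF := explicit_formula χ hχ2 hχ1 hApos hBpos
  -- (3) the three terms
  have hg0 : ‖gFun χ 0‖ ≤ 3 * ‖χ.LFunction 1‖ ^ 2 := by
    have hφ1 : ‖phi D (1 + 0)‖ ≤ 3 :=
      norm_phi_one_add_le (N := D) hL1 (by rw [norm_zero]; positivity) (by rw [norm_zero]; norm_num)
    rw [gFun, norm_mul, norm_pow, add_zero]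
    rw [add_zero] at hφ1
    calc ‖χ.LFunction 1‖ ^ 2 * ‖phi D 1‖ ≤ ‖χ.LFunction 1‖ ^ 2 * 3 := by gcongr
      _ = 3 * ‖χ.LFunction 1‖ ^ 2 := by ring
  have hT1 : ‖gFun χ 0 * (W dCoeff B - W dCoeff A)‖ ≤ 27 / Lg ^ k := by
    rw [norm_mul]
    have hW := norm_W_dCoeff_sub_le hApos hAB
    have hLsq : ‖χ.LFunction 1‖ ^ 2 ≤ (1 / Lg ^ (k + x + 2)) ^ 2 :=
      pow_le_pow_left₀ (norm_nonneg _) hA' 2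
    have hlog2 : Real.log (1 + 2 * B) ^ 2 ≤ (3 * Lg ^ x) ^ 2 :=
      pow_le_pow_left₀ (Real.log_nonneg (by linarith)) hlogB 2
    have hpow : (Lg ^ (k + x + 2)) ^ 2 = (Lg ^ x) ^ 2 * Lg ^ k * Lg ^ (k + 4) := by
      rw [← pow_mul, ← pow_mul, ← pow_add, ← pow_add]; ring_nf
    calc ‖gFun χ 0‖ * ‖W dCoeff B - W dCoeff A‖
        ≤ (3 * (1 / Lg ^ (k + x + 2)) ^ 2) * (3 * Lg ^ x) ^ 2 := by
          refine mul_le_mul (hg0.trans (by linarith)) (hW.trans hlog2) (norm_nonneg _) (by positivity)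
      _ = 27 / Lg ^ k * (1 / Lg ^ (k + 4)) := by rw [div_pow, one_pow, hpow]; field_simp; norm_num
      _ ≤ 27 / Lg ^ k * 1 := by
          gcongr
          rw [div_le_one (by positivity)]; exact one_le_pow₀ hL1
      _ = 27 / Lg ^ k := by ring
  have hT2 : ‖((Real.log B : ℂ) - (Real.log A : ℂ)) * deriv (gFun χ) 0‖ ≤
      6 * (1 + 4 * Real.exp (9 / 2)) ^ 2 / Lg ^ k := by
    rw [norm_mul, ← ofReal_sub, Complex.norm_real, Real.norm_eq_abs]
    have hr1 : 1 / Lg ^ (k + x + 4) ≤ 1 / Real.log D := by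
      rw [← hLdef]
      refine div_le_div_of_nonneg_left (by norm_num) hL0 ?_
      calc Lg = Lg ^ 1 := (pow_one Lg).symm
        _ ≤ Lg ^ (k + x + 4) := pow_le_pow_right₀ hL1 (by omega)
    have hr4 : 1 / Lg ^ (k + x + 4) ≤ 1 / 4 := by
      refine div_le_div_of_nonneg_left (by norm_num) (by norm_num) ?_
      calc (4 : ℝ) ≤ 3 ^ 2 := by norm_num
        _ ≤ Lg ^ 2 := pow_le_pow_left₀ (by norm_num) hL 2
        _ ≤ Lg ^ (k + x + 4) := pow_le_pow_right₀ hL1 (by omega)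
    have hder := norm_deriv_gFun_zero_le χ hprim hL (r := 1 / Lg ^ (k + x + 4)) (by positivity) hr1 hr4
    rw [← hLdef] at hder
    have hder' := hder.trans (aux_deriv_scale (k + x) hL1 (norm_nonneg _) hA')
    have hkx : Lg ^ (k + x) = Lg ^ x * Lg ^ k := by rw [← pow_add]; ring_nf
    calc |Real.log B - Real.log A| * ‖deriv (gFun χ) 0‖
        ≤ (2 * Lg ^ x) * (3 * (1 + 4 * Real.exp (9 / 2)) ^ 2 / Lg ^ (k + x)) :=
          mul_le_mul hΔlog hder' (norm_nonneg _) (by positivity)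
      _ = 6 * (1 + 4 * Real.exp (9 / 2)) ^ 2 / Lg ^ k := by
          rw [hkx]; field_simp; norm_num
  have hT3 : ‖(1 / (2 * (π : ℂ))) * ∫ y : ℝ, numer χ A B ((-(1 / 4) : ℝ) + y * I) /
      (((-(1 / 4) : ℝ) : ℂ) + y * I - 0)‖ ≤
      16 * 28 ^ 13 * Kline * Cd ^ 2 * (8 * M) / Lg ^ k := by
    rw [norm_mul]
    have hπ1 : ‖(1 / (2 * (π : ℂ)))‖ ≤ 1 := by
      rw [norm_div, norm_one, norm_mul, Complex.norm_ofNat, Complex.norm_real, Real.norm_eq_abs,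
        abs_of_pos Real.pi_pos, div_le_one (by positivity)]
      linarith [Real.pi_gt_three]
    have hI := norm_integral_line_le χ hprim hD8 hL1 hLA1 hApos hBpos
    -- the `D`-bookkeeping: `t = D^{1/8}`
    set t : ℝ := (D : ℝ) ^ (1 / 8 : ℝ) with htdef
    have ht0 : 0 < t := by positivity
    have ht2 : (D : ℝ) ^ (1 / 4 : ℝ) = t ^ 2 := by
      rw [htdef, ← Real.rpow_natCast, ← Real.rpow_mul hDpos.le]; norm_num
    have ht4 : (D : ℝ) ^ (1 / 2 : ℝ) = t ^ 4 := by
      rw [htdef, ← Real.rpow_natCast, ← Real.rpow_mul hDpos.le]; norm_num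
    have ht8 : (D : ℝ) = t ^ 8 := by
      rw [htdef, ← Real.rpow_natCast, ← Real.rpow_mul hDpos.le]; norm_num
    have hτ : (D.divisors.card : ℝ) ≤ Cd * t := hCd D hD0
    have hτ2 : (D.divisors.card : ℝ) ^ 2 ≤ (Cd * t) ^ 2 :=
      pow_le_pow_left₀ (Nat.cast_nonneg _) hτ 2
    have hlp := aux_logpow_scale k (D := D) hL1 hDpos
    rw [ht4, ← hLdef, ← hM] at hlp
    have hK := Kline_pos
    have hmain : Kline * (D.divisors.card : ℝ) ^ 2 * (D : ℝ) ^ (1 / 4 : ℝ) * (1 + Lg) ^ 3 *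
        (A ^ (-(1 / 4) : ℝ) + B ^ (-(1 / 4) : ℝ)) ≤
        2 * Kline * Cd ^ 2 * (8 * M / Lg ^ k) := by
      calc Kline * (D.divisors.card : ℝ) ^ 2 * (D : ℝ) ^ (1 / 4 : ℝ) * (1 + Lg) ^ 3 *
            (A ^ (-(1 / 4) : ℝ) + B ^ (-(1 / 4) : ℝ))
          ≤ Kline * (Cd * t) ^ 2 * t ^ 2 * (1 + Lg) ^ 3 * (2 / D) := by
            rw [ht2]; gcongr
        _ = 2 * Kline * Cd ^ 2 * ((1 + Lg) ^ 3 / t ^ 4) := by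
            rw [ht8]; field_simp
        _ ≤ 2 * Kline * Cd ^ 2 * (8 * M / Lg ^ k) := by gcongr
    calc ‖(1 / (2 * (π : ℂ)))‖ * ‖∫ y : ℝ, numer χ A B ((-(1 / 4) : ℝ) + y * I) /
          (((-(1 / 4) : ℝ) : ℂ) + y * I - 0)‖
        ≤ 1 * (8 * 28 ^ 13 * (Kline * (D.divisors.card : ℝ) ^ 2 * (D : ℝ) ^ (1 / 4 : ℝ) *
            (1 + Real.log D) ^ 3 * (A ^ (-(1 / 4) : ℝ) + B ^ (-(1 / 4) : ℝ)))) :=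
          mul_le_mul hπ1 hI (norm_nonneg _) (by norm_num)
      _ ≤ 1 * (8 * 28 ^ 13 * (2 * Kline * Cd ^ 2 * (8 * M / Lg ^ k))) := by
          rw [← hLdef]; gcongr
      _ = 16 * 28 ^ 13 * Kline * Cd ^ 2 * (8 * M) / Lg ^ k := by ring
  -- (4) combine
  have hΔ : ‖W (fun n => divisorSumChar χ n ^ 2) B - W (fun n => divisorSumChar χ n ^ 2) A‖ ≤
      (27 + 6 * (1 + 4 * Real.exp (9 / 2)) ^ 2 + 16 * 28 ^ 13 * Kline * Cd ^ 2 * (8 * M)) /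
        Lg ^ k := by
    rw [hEF]
    refine (norm_add_le _ _).trans ?_
    refine (add_le_add (norm_add_le _ _) le_rfl).trans ?_
    rw [add_div, add_div]
    exact add_le_add (add_le_add hT1 hT2) hT3
  calc ∑ n ∈ Finset.Ioc (D ^ 4) N, ‖divisorSumChar χ n‖ ^ 2 / n
      ≤ 6 * (W (fun n => divisorSumChar χ n ^ 2) B - W (fun n => divisorSumChar χ n ^ 2) A).re := hS
    _ ≤ 6 * ‖W (fun n => divisorSumChar χ n ^ 2) B - W (fun n => divisorSumChar χ n ^ 2) A‖ := by
        gcongr; exact Complex.re_le_norm _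
    _ ≤ 6 * ((27 + 6 * (1 + 4 * Real.exp (9 / 2)) ^ 2 +
          16 * 28 ^ 13 * Kline * Cd ^ 2 * (8 * M)) / Lg ^ k) := by gcongr
    _ = _ := by rw [hLdef]; ring

/-- **Lemma 3.1 with the exponents free, printed shape** `∑_{D⁴<n≤⌊exp(2𝓛^{x})⌋}` (at `x = x_P` this is
`n ≤ P²`, `P = exp 𝓛^{x_P}` (2.6)): saving `𝓛^{−k}` from `‖L(1,χ)‖ ≤ 𝓛^{−(k+2+x)}`, `log D ≥ 3`, `x ≥ 2`.
[cite: Zhang2022LandauSiegel, §3, Lemma 3.1] -/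
theorem lemma31_scale_floor (x k : ℕ) (hx : 2 ≤ x) :
    ∃ C : ℝ, ∀ (D : ℕ) [NeZero D] (χ : DirichletCharacter ℂ D),
    χ.IsPrimitive → χ ^ 2 = 1 → 3 ≤ Real.log D →
    ‖χ.LFunction 1‖ ≤ 1 / Real.log D ^ (k + 2 + x) →
      ∑ n ∈ Finset.Ioc (D ^ 4) ⌊Real.exp (2 * Real.log D ^ x)⌋₊, ‖divisorSumChar χ n‖ ^ 2 / n ≤
        C / Real.log D ^ k := by
  obtain ⟨C, hC⟩ := lemma31_scale_of_norm_le x k hx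
  exact ⟨C, fun D _ χ hprim hχ2 hL hA =>
    hC D χ hprim hχ2 hL hA _ (Nat.floor_le (Real.exp_pos _).le)⟩

/-- **Lemma 3.1 with the exponents free, complex form** (`ν(n)² = |ν(n)|²` for `χ² = 1`):
`‖∑_{D⁴<n≤N} ν(n)²/n‖ ≤ C𝓛^{−k}` for `N ≤ exp(2𝓛^{x})` from `‖L(1,χ)‖ ≤ 𝓛^{−(k+2+x)}`, `log D ≥ 3`, `x ≥ 2`.
[cite: Zhang2022LandauSiegel, §3, Lemma 3.1] -/
theorem lemma31_scale_complex (x k : ℕ) (hx : 2 ≤ x) :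
    ∃ C : ℝ, ∀ (D : ℕ) [NeZero D] (χ : DirichletCharacter ℂ D),
    χ.IsPrimitive → χ ^ 2 = 1 → 3 ≤ Real.log D →
    ‖χ.LFunction 1‖ ≤ 1 / Real.log D ^ (k + 2 + x) →
    ∀ N : ℕ, (N : ℝ) ≤ Real.exp (2 * Real.log D ^ x) →
      ‖∑ n ∈ Finset.Ioc (D ^ 4) N, divisorSumChar χ n ^ 2 / (n : ℂ)‖ ≤ C / Real.log D ^ k := by
  obtain ⟨C, hC⟩ := lemma31_scale_of_norm_le x k hx
  refine ⟨C, fun D _ χ hprim hχ2 hL hA N hN => ?_⟩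
  have h := hC D χ hprim hχ2 hL hA N hN
  have hsum : ∑ n ∈ Finset.Ioc (D ^ 4) N, divisorSumChar χ n ^ 2 / (n : ℂ) =
      ((∑ n ∈ Finset.Ioc (D ^ 4) N, ‖divisorSumChar χ n‖ ^ 2 / n : ℝ) : ℂ) := by
    push_cast
    refine Finset.sum_congr rfl fun n _ => ?_
    rw [divisorSumChar_sq_eq χ hχ2 n]
    push_cast
    rfl
  rw [hsum, Complex.norm_real, Real.norm_eq_abs, abs_of_nonneg]
  · exact h
  · exact Finset.sum_nonneg fun n _ => by positivity

/-! ## From `AssumptionAWith E`, every real `E ≥ k + 2 + x` -/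

/-- `AssumptionAWith E D χ` with `E ≥ e` (`e` natural, `log D ≥ 1`) gives the natural-power premise
`‖L(1,χ)‖ ≤ 1/(log D)^{e}`. [cite: Zhang2022LandauSiegel, §2 Assumption (A)] -/
theorem norm_le_pow_of_assumptionAWith {D : ℕ} [NeZero D] (χ : DirichletCharacter ℂ D)
    (hL : 1 ≤ Real.log D) {e : ℕ} {E : ℝ} (hE : (e : ℝ) ≤ E) (hA : AssumptionAWith E D χ) :
    ‖χ.LFunction 1‖ ≤ 1 / Real.log D ^ e := by
  unfold AssumptionAWith at hA
  refine (le_of_lt hA).trans ?_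
  have hL0 : 0 < Real.log D := by linarith
  rw [← Real.rpow_natCast]
  exact one_div_le_one_div_of_le (Real.rpow_pos_of_pos hL0 _)
    (Real.rpow_le_rpow_of_exponent_le hL hE)

/-- **Lemma 3.1 with the exponents free, from `AssumptionAWith E`** for every real `E ≥ k + 2 + x` (`x ≥ 2`):
`∑_{D⁴<n≤N} |ν(n)|²/n ≤ C𝓛^{−k}` for `N ≤ exp(2𝓛^{x})`, `log D ≥ 3`, `χ` primitive with `χ² = 1`. At the printed
`x_P = 9` the desk's S0 line reads: (A) at exponent `E` yields Lemma 3.1 with saving `E − 11`.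
[cite: Zhang2022LandauSiegel, §3, Lemma 3.1] -/
theorem lemma31_scale_of_assumptionAWith (x k : ℕ) (hx : 2 ≤ x) {E : ℝ} (hE : ((k + 2 + x : ℕ) : ℝ) ≤ E) :
    ∃ C : ℝ, ∀ (D : ℕ) [NeZero D] (χ : DirichletCharacter ℂ D),
    χ.IsPrimitive → χ ^ 2 = 1 → 3 ≤ Real.log D → AssumptionAWith E D χ →
    ∀ N : ℕ, (N : ℝ) ≤ Real.exp (2 * Real.log D ^ x) →
      ∑ n ∈ Finset.Ioc (D ^ 4) N, ‖divisorSumChar χ n‖ ^ 2 / n ≤ C / Real.log D ^ k := by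
  obtain ⟨C, hC⟩ := lemma31_scale_of_norm_le x k hx
  exact ⟨C, fun D _ χ hprim hχ2 hL hA N hN =>
    hC D χ hprim hχ2 hL (norm_le_pow_of_assumptionAWith χ (by linarith) hE hA) N hN⟩

/-- **The short tail consumed by Lemma 17.1** (Appendix B: `∑_{D⁴<n≤D⁸} ν(n)²/n = o(1)` "by Lemma 3.1"): the case
`x = 3` (`D⁸ = exp(8𝓛) ≤ exp(2𝓛³)` once `𝓛 ≥ 2`) — saving `𝓛^{−k}` from `‖L(1,χ)‖ ≤ 𝓛^{−(k+5)}`, `log D ≥ 3`.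
[cite: Zhang2022LandauSiegel, §3, Lemma 3.1; App. B] -/
theorem lemma31_short_tail_of_norm_le (k : ℕ) :
    ∃ C : ℝ, ∀ (D : ℕ) [NeZero D] (χ : DirichletCharacter ℂ D),
    χ.IsPrimitive → χ ^ 2 = 1 → 3 ≤ Real.log D →
    ‖χ.LFunction 1‖ ≤ 1 / Real.log D ^ (k + 5) →
      ∑ n ∈ Finset.Ioc (D ^ 4) (D ^ 8), ‖divisorSumChar χ n‖ ^ 2 / n ≤ C / Real.log D ^ k := by
  obtain ⟨C, hC⟩ := lemma31_scale_of_norm_le 3 k (by norm_num)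
  refine ⟨C, fun D _ χ hprim hχ2 hL hA => hC D χ hprim hχ2 hL hA (D ^ 8) ?_⟩
  set Lg : ℝ := Real.log D with hLdef
  have hD0 : (0 : ℝ) < D := by
    rcases Nat.eq_zero_or_pos D with h | h
    · rw [h] at hLdef; simp [hLdef] at hL; linarith
    · exact_mod_cast h
  push_cast
  rw [← Real.exp_log (pow_pos hD0 8), Real.exp_le_exp, Real.log_pow, ← hLdef]
  push_cast
  have h2 : (4 : ℝ) ≤ Lg ^ 2 := by nlinarith
  nlinarith

end Literature.NumberTheory.LFunctions.Zhang2022.Repair.Gap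

end
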